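import Summits.ABC.ABC.Theorems.PrimePowerRadical.Negative.Orders
import Summits.ABC.ABC.Theorems.PrimePowerRadical.Negative.DoubleWall
import Summits.ABC.ABC.Theorems.PrimePowerRadical.Negative.LinearLoss

/-!
# Bottom of the loss dial: linear loss iff finitely many Wieferich primes

For a prime base `q`, the LINEAR-loss bound `q^k < C·k·rad(1·(q^k−1)·q^k)` (one constant `C`, all
`k ≥ 1`) holds if and only if `q` has only finitely many Wieferich primes
(`IsWieferich q p : q^(p−1) ≡ 1 [MOD p^2]`).

* `⟸`: finitely many Wieferich primes bound the odd Wieferich excess `E_W(q,k)` uniformly in `k`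
  (`oddWieferichExcess_le_of_levels_bounded`), and the upper sandwich
  `q^k − 1 ≤ k·rad(q^k−1)·E_W(q,k)·2^{W_2(q)}` (`oddWieferichExcess_sandwich`) gives linear loss.
* `⟹` (by contraposition): pick `2m` Wieferich primes `p > q` with `m > C·q + 1` and let `k` be the
  lcm of the orders `ord_p(q)`. Each such `p` divides `E_W(q,k)`, so
  `(∏ p)·rad(q^k−1) ≤ E_W·rad(q^k−1) ≤ q^k − 1 < q^k < C·k·rad(q^k−1)·q`, while the combinatorial
  core `ll_pow_mul_lcm_le_prod` gives `2^{m−1}·k ≤ ∏ p` (full orders `p − 1` are even and share the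
  factor `2`, proper-divisor orders are `≤ (p−1)/2`). Hence `m ≤ 2^{m−1} < C·q < m`: contradiction.

Sources: card `adelic-brjuno-summability` (crux stmt-ABC-1648, line `Sketch`), ported from
`Cruxes/PrimePowerRadical/SketchIdeator2g2.lean` (`linearLoss_iff_finite_wieferich` and its three
helpers `two_mul_le_of_dvd_of_ne`, `lcm_le_prod`, `pow_mul_lcm_le_prod`, here prefixed `ll_`).
Deliberately NOT here: the super-linear rungs of the dial (the adelic Brjuno sum `WDC`,
Romanoff-type expectations, `o(k^a)` excess bounds).
-/

noncomputable section

-- `Summit.<Summit>.<Problem>` is the mandated summit-side namespace (CONVENTIONS §2); for the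
-- single-conjunct summit `ABC` the two coincide, so the duplicate `ABC.ABC` is deliberate.
set_option linter.dupNamespace false

namespace Summit.ABC.ABC.Theorems.PrimePowerRadical.Brjuno

open Literature.NumberTheory.DiophantineGeometry UniqueFactorizationMonoid
open Summit.ABC.ABC.Theses.IneffectiveSubspace
open Summit.ABC.ABC.Theorems.PrimePowerRadical.Negative
open scoped BigOperators

/-- A proper divisor of a positive natural number is at most half of it. -/
theorem ll_two_mul_le_of_dvd_of_ne {d n : ℕ} (hn : 0 < n) (hd : d ∣ n) (hne : d ≠ n) :
    2 * d ≤ n := by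
  obtain ⟨c, hc⟩ := hd
  have hc0 : c ≠ 0 := by rintro rfl; rw [mul_zero] at hc; omega
  have hc1 : c ≠ 1 := by rintro rfl; rw [mul_one] at hc; exact hne hc.symm
  have hc2 : 2 ≤ c := by omega
  calc 2 * d = d * 2 := by ring
    _ ≤ d * c := Nat.mul_le_mul_left d hc2
    _ = n := hc.symm

/-- `lcm ≤ product` over a finset, for a positive-valued function. -/
theorem ll_lcm_le_prod {T : Finset ℕ} (f : ℕ → ℕ) (hpos : ∀ p ∈ T, 0 < f p) :
    T.lcm f ≤ ∏ p ∈ T, f p := by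
  apply Nat.le_of_dvd (Finset.prod_pos hpos)
  exact Finset.lcm_dvd fun b hb => Finset.dvd_prod_of_mem f hb

/-- COMBINATORIAL CORE: if `T` consists of `2m` odd numbers `p ≥ 3` and `d p` is a positive divisor of
`p − 1` for each `p ∈ T`, then `2^{m−1} · lcm_{p ∈ T} d p ≤ ∏_{p ∈ T} p`. (Those `p` with the full
value `d p = p − 1` have even `d p`, all sharing the factor `2`; the others have `d p ≤ (p−1)/2`.) -/
theorem ll_pow_mul_lcm_le_prod {T : Finset ℕ} {m : ℕ} (hcard : T.card = 2 * m) (d : ℕ → ℕ)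
    (hT : ∀ p ∈ T, 3 ≤ p ∧ 0 < d p ∧ d p ∣ p - 1 ∧ ¬ 2 ∣ p) :
    2 ^ (m - 1) * T.lcm d ≤ ∏ p ∈ T, p := by
  classical
  rcases Nat.eq_zero_or_pos m with rfl | hm
  · have hT0 : T = ∅ := Finset.card_eq_zero.mp (by omega)
    subst hT0
    simp
  set A := T.filter (fun p => d p = p - 1) with hA
  set B := T.filter (fun p => ¬ d p = p - 1) with hB
  have hcardAB : A.card + B.card = 2 * m := by
    rw [hA, hB, Finset.card_filter_add_card_filter_not]; exact hcard
  have hprodT : (∏ p ∈ A, p) * (∏ p ∈ B, p) = ∏ p ∈ T, p := by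
    rw [hA, hB]; exact Finset.prod_filter_mul_prod_filter_not T _ _
  -- `T.lcm d` divides `(A.lcm d) * (B.lcm d)`
  have hsplit : T.lcm d ∣ A.lcm d * B.lcm d := by
    apply Finset.lcm_dvd
    intro p hp
    by_cases h : d p = p - 1
    · have hpA : p ∈ A := Finset.mem_filter.mpr ⟨hp, h⟩
      exact dvd_mul_of_dvd_left (Finset.dvd_lcm hpA) _
    · have hpB : p ∈ B := Finset.mem_filter.mpr ⟨hp, h⟩
      exact dvd_mul_of_dvd_right (Finset.dvd_lcm hpB) _
  -- `B` part: `2^{|B|} * B.lcm d ≤ ∏_B p` (each `d p ≤ (p-1)/2`)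
  have hBd : ∀ p ∈ B, 0 < d p ∧ 2 * d p ≤ p := by
    intro p hp
    obtain ⟨hpT, hne⟩ := Finset.mem_filter.mp hp
    obtain ⟨hp3, hdpos, hdvd, -⟩ := hT p hpT
    refine ⟨hdpos, ?_⟩
    have := ll_two_mul_le_of_dvd_of_ne (by omega) hdvd hne
    omega
  have hBbound : 2 ^ B.card * B.lcm d ≤ ∏ p ∈ B, p := by
    have h1 : B.lcm d ≤ ∏ p ∈ B, d p := ll_lcm_le_prod d fun p hp => (hBd p hp).1
    have h2 : ∏ p ∈ B, (2 * d p) ≤ ∏ p ∈ B, p := Finset.prod_le_prod' fun p hp => (hBd p hp).2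
    have h3 : ∏ p ∈ B, (2 * d p) = 2 ^ B.card * ∏ p ∈ B, d p := by
      rw [Finset.prod_mul_distrib, Finset.prod_const]
    calc 2 ^ B.card * B.lcm d ≤ 2 ^ B.card * ∏ p ∈ B, d p := Nat.mul_le_mul_left _ h1
      _ = ∏ p ∈ B, (2 * d p) := h3.symm
      _ ≤ ∏ p ∈ B, p := h2
  -- `A` part: `2^{|A|} * A.lcm d ≤ 2 * ∏_A p` (all `d p = p - 1` are even)
  set g : ℕ → ℕ := fun p => (p - 1) / 2
  have hAd : ∀ p ∈ A, d p = 2 * g p ∧ 0 < g p ∧ 2 * g p ≤ p := by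
    intro p hp
    obtain ⟨hpT, heq⟩ := Finset.mem_filter.mp hp
    obtain ⟨hp3, -, -, hodd⟩ := hT p hpT
    have heven : 2 ∣ p - 1 := by omega
    have hg' : g p = (p - 1) / 2 := rfl
    refine ⟨?_, ?_, ?_⟩
    · rw [heq, hg']; omega
    · rw [hg']; omega
    · rw [hg']; omega
  have hAbound : 2 ^ A.card * A.lcm d ≤ 2 * ∏ p ∈ A, p := by
    have h1 : A.lcm d ∣ 2 * A.lcm g := by
      apply Finset.lcm_dvd
      intro p hp
      rw [(hAd p hp).1]
      exact mul_dvd_mul_left 2 (Finset.dvd_lcm hp)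
    have hgpos : 0 < A.lcm g := by
      rw [Nat.pos_iff_ne_zero, Ne, Finset.lcm_eq_zero_iff]
      rintro ⟨p, hp, h0⟩
      have := (hAd p hp).2.1
      omega
    have h2 : A.lcm d ≤ 2 * A.lcm g := Nat.le_of_dvd (by omega) h1
    have h3 : A.lcm g ≤ ∏ p ∈ A, g p := ll_lcm_le_prod g fun p hp => (hAd p hp).2.1
    have h4 : ∏ p ∈ A, (2 * g p) ≤ ∏ p ∈ A, p := Finset.prod_le_prod' fun p hp => (hAd p hp).2.2
    have h5 : ∏ p ∈ A, (2 * g p) = 2 ^ A.card * ∏ p ∈ A, g p := by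
      rw [Finset.prod_mul_distrib, Finset.prod_const]
    calc 2 ^ A.card * A.lcm d ≤ 2 ^ A.card * (2 * A.lcm g) := Nat.mul_le_mul_left _ h2
      _ = 2 * (2 ^ A.card * A.lcm g) := by ring
      _ ≤ 2 * (2 ^ A.card * ∏ p ∈ A, g p) := by
          apply Nat.mul_le_mul_left; exact Nat.mul_le_mul_left _ h3
      _ = 2 * ∏ p ∈ A, (2 * g p) := by rw [h5]
      _ ≤ 2 * ∏ p ∈ A, p := Nat.mul_le_mul_left _ h4
  -- combine: `2^{|A|+|B|} * T.lcm d ≤ 2 * ∏_T p`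
  have hApos' : 0 < A.lcm d := by
    rw [Nat.pos_iff_ne_zero, Ne, Finset.lcm_eq_zero_iff]
    rintro ⟨p, hp, h0⟩
    have := (hT p (Finset.mem_filter.mp hp).1).2.1
    omega
  have hBpos' : 0 < B.lcm d := by
    rw [Nat.pos_iff_ne_zero, Ne, Finset.lcm_eq_zero_iff]
    rintro ⟨p, hp, h0⟩
    have := (hT p (Finset.mem_filter.mp hp).1).2.1
    omega
  have hTle : T.lcm d ≤ A.lcm d * B.lcm d := Nat.le_of_dvd (Nat.mul_pos hApos' hBpos') hsplit
  have hmain : 2 ^ (A.card + B.card) * T.lcm d ≤ 2 * ∏ p ∈ T, p := by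
    calc 2 ^ (A.card + B.card) * T.lcm d
        ≤ 2 ^ (A.card + B.card) * (A.lcm d * B.lcm d) := Nat.mul_le_mul_left _ hTle
      _ = (2 ^ A.card * A.lcm d) * (2 ^ B.card * B.lcm d) := by rw [pow_add]; ring
      _ ≤ (2 * ∏ p ∈ A, p) * (∏ p ∈ B, p) := Nat.mul_le_mul hAbound hBbound
      _ = 2 * ∏ p ∈ T, p := by rw [← hprodT]; ring
  -- `2^(m-1) * 2 ≤ 2^(2m)` as `m ≥ 1`
  rw [hcardAB] at hmain
  have hpow : 2 ^ (m - 1) * 2 ≤ 2 ^ (2 * m) := by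
    rw [← pow_succ]
    apply Nat.pow_le_pow_right (by norm_num)
    omega
  have h1 : 2 ^ (m - 1) * T.lcm d * 2 ≤ 2 ^ (2 * m) * T.lcm d := by
    calc 2 ^ (m - 1) * T.lcm d * 2 = (2 ^ (m - 1) * 2) * T.lcm d := by ring
      _ ≤ 2 ^ (2 * m) * T.lcm d := Nat.mul_le_mul_right _ hpow
  have h2 : 2 ^ (m - 1) * T.lcm d * 2 ≤ 2 * ∏ p ∈ T, p := le_trans h1 hmain
  omega

/-- BOTTOM OF THE LOSS DIAL: for a prime base `q`, LINEAR loss `q^k < C·k·rad(1·(q^k−1)·q^k)`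
(for all `k ≥ 1`) holds IFF `q` has only FINITELY many Wieferich primes. `⟸`: `E_W(q,k)` is bounded
and the upper sandwich. `⟹`: take `2m` Wieferich primes `p > q`, `k := lcm` of their orders; then
`E_W(q,k) ≥ ∏ p` while `2^{m−1}·k ≤ ∏ p` (`ll_pow_mul_lcm_le_prod`), forcing `2^{m−1} < C·q`. -/
theorem stub_linearLoss_iff_finite_wieferich {q : ℕ} (hq : q.Prime) :
    (∃ C : ℝ, ∀ k : ℕ, 1 ≤ k →
        ((q ^ k : ℕ) : ℝ) < C * (k : ℝ) * ((rad 1 (q ^ k - 1) (q ^ k) : ℕ) : ℝ)) ↔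
      {p : ℕ | p.Prime ∧ IsWieferich q p}.Finite := by
  classical
  have hq2 := hq.two_le
  have hq0 : (0 : ℝ) < q := by exact_mod_cast hq.pos
  constructor
  · -- (⟹) by contraposition: infinitely many Wieferich primes defeat every linear constant
    intro ⟨C, hC⟩
    by_contra hinf
    rw [← Set.not_infinite, not_not] at hinf
    -- `C > 0` from `k = 1`
    have hC0 : 0 < C := by
      have h := hC 1 le_rfl
      have hR0 : (0 : ℝ) ≤ ((rad 1 (q ^ 1 - 1) (q ^ 1) : ℕ) : ℝ) := Nat.cast_nonneg _
      have hqk : (0 : ℝ) ≤ ((q ^ 1 : ℕ) : ℝ) := Nat.cast_nonneg _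
      by_contra hle
      have hle' : C * ((1 : ℕ) : ℝ) ≤ 0 := by
        rw [Nat.cast_one, mul_one]; exact not_lt.mp hle
      have : C * ((1 : ℕ) : ℝ) * ((rad 1 (q ^ 1 - 1) (q ^ 1) : ℕ) : ℝ) ≤ 0 :=
        mul_nonpos_of_nonpos_of_nonneg hle' hR0
      linarith
    -- choose `m > C q + 1`; then `2^(m-1) ≥ m > C q`
    obtain ⟨m, hm⟩ := exists_nat_gt (C * q + 1)
    have hm1 : 1 ≤ m := by
      have h1 : (1 : ℝ) < m := by
        have : (0 : ℝ) < C * q := mul_pos hC0 hq0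
        linarith
      exact_mod_cast h1.le
    have hpow_m : (m : ℝ) ≤ (2 : ℝ) ^ (m - 1) := by
      have : m ≤ 2 ^ (m - 1) := by
        have h := Nat.lt_two_pow_self (n := m - 1)
        omega
      exact_mod_cast this
    -- an infinite supply of Wieferich primes `p > q`
    set W : Set ℕ := {p : ℕ | p.Prime ∧ IsWieferich q p} with hW
    have hFfin : ({p : ℕ | p ≤ q} : Set ℕ).Finite := Set.finite_le_nat q
    have hW' : (W \ {p : ℕ | p ≤ q}).Infinite := hinf.sdiff hFfin
    obtain ⟨T, hTsub, hTcard⟩ := hW'.exists_subset_card_eq (2 * m)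
    have hTmem : ∀ p ∈ T, p.Prime ∧ IsWieferich q p ∧ q < p := by
      intro p hp
      have := hTsub (Finset.mem_coe.mpr hp)
      simp only [Set.mem_sdiff, hW, Set.mem_setOf_eq, not_le] at this
      exact ⟨this.1.1, this.1.2, this.2⟩
    have hTfacts : ∀ p ∈ T, p.Prime ∧ p ≠ 2 ∧ ¬ p ∣ q ∧ 2 ≤ wieferichLevel q p ∧ 0 < ordMod q p := by
      intro p hp
      obtain ⟨hpr, hWp, hqp⟩ := hTmem p hp
      have hp2 : p ≠ 2 := by omega
      have hpq : ¬ p ∣ q := fun h => by have := Nat.le_of_dvd hq.pos h; omega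
      refine ⟨hpr, hp2, hpq, ?_, ordMod_pos hpr hpq⟩
      exact (isWieferich_iff_two_le_wieferichLevel hq2 hpr hp2 hpq).mp hWp
    -- `k := lcm` of the orders
    set k : ℕ := T.lcm (ordMod q) with hk
    have hkpos : 0 < k := by
      rw [hk, Nat.pos_iff_ne_zero, Ne, Finset.lcm_eq_zero_iff]
      rintro ⟨p, hp, h0⟩
      have := (hTfacts p hp).2.2.2.2
      omega
    have hk1 : 1 ≤ k := hkpos
    -- every `p ∈ T` divides `E_W(q,k)`
    have hn : q ^ k - 1 ≠ 0 := by have := two_le_pow hq2 hk1; omega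
    have hE0 := (oddWieferichExcess_pos q k).ne'
    have hdvdE : ∀ p ∈ T, p ^ 1 ∣ oddWieferichExcess q k := by
      intro p hp
      obtain ⟨hpr, hp2, -, hWp, -⟩ := hTfacts p hp
      have hdk : ordMod q p ∣ k := Finset.dvd_lcm hp
      have hpk : p ∣ q ^ k - 1 := (dvd_pow_sub_one_iff_ordMod_dvd hpr (by omega) k).mpr hdk
      have hmem : p ∈ (q ^ k - 1).primeFactors.erase 2 :=
        Finset.mem_erase.mpr ⟨hp2, Nat.mem_primeFactors.mpr ⟨hpr, hpk, hn⟩⟩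
      have h1 : p ^ (wieferichLevel q p - 1) ∣ oddWieferichExcess q k := by
        unfold oddWieferichExcess
        exact Finset.dvd_prod_of_mem (fun r => r ^ (wieferichLevel q r - 1)) hmem
      rw [pow_one]
      exact dvd_trans (dvd_pow_self p (by omega)) h1
    have hprod_dvd : ∏ p ∈ T, p ^ 1 ∣ oddWieferichExcess q k :=
      prod_prime_pow_dvd_of_forall_dvd (fun r hr => (hTfacts r hr).1) (fun _ => 1) hE0 hdvdE
    have hprod_dvd' : ∏ p ∈ T, p ∣ oddWieferichExcess q k := by
      have : ∏ p ∈ T, p ^ 1 = ∏ p ∈ T, p := Finset.prod_congr rfl fun p _ => pow_one p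
      rwa [this] at hprod_dvd
    have hPle : ∏ p ∈ T, p ≤ oddWieferichExcess q k :=
      Nat.le_of_dvd (oddWieferichExcess_pos q k) hprod_dvd'
    -- lower bound: `(∏ p) * rad(q^k-1) ≤ E_W * rad ≤ q^k - 1 < q^k` (in `ℕ`)
    have hsand := (oddWieferichExcess_sandwich hq hk1).1
    have hlow : (∏ p ∈ T, p) * radical (q ^ k - 1) < q ^ k := by
      calc (∏ p ∈ T, p) * radical (q ^ k - 1) ≤ oddWieferichExcess q k * radical (q ^ k - 1) :=
            Nat.mul_le_mul_right _ hPle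
        _ ≤ q ^ k - 1 := hsand
        _ < q ^ k := Nat.sub_lt (pow_pos hq.pos k) one_pos
    -- upper bound from linear loss: `q^k < C k rad_fam = C k (rad * q)`
    have hup := hC k hk1
    rw [rad_family_eq hq hk1] at hup
    -- combinatorial core: `2^(m-1) * k ≤ ∏ p`
    have hcomb : 2 ^ (m - 1) * k ≤ ∏ p ∈ T, p := by
      rw [hk]
      apply ll_pow_mul_lcm_le_prod hTcard (ordMod q)
      intro p hp
      obtain ⟨hpr, -, hpq, -, hdpos⟩ := hTfacts p hp
      have hp3 : 3 ≤ p := by have := (hTmem p hp).2.2; omega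
      refine ⟨hp3, hdpos, ordMod_dvd_sub_one hpr hpq, ?_⟩
      intro h2
      have := (Nat.prime_dvd_prime_iff_eq Nat.prime_two hpr).mp h2
      omega
    -- in `ℝ`: `2^(m-1) k rad ≤ (∏p) rad < q^k < C k rad q  ⟹  2^(m-1) < C q`, contradiction
    have hR0 : (0 : ℝ) < ((radical (q ^ k - 1) : ℕ) : ℝ) := by
      exact_mod_cast Nat.pos_of_ne_zero radical_ne_zero
    have hkR : (0 : ℝ) < k := by exact_mod_cast hkpos
    have h1 : (2 : ℝ) ^ (m - 1) * k * ((radical (q ^ k - 1) : ℕ) : ℝ) <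
        C * k * (((radical (q ^ k - 1) : ℕ) : ℝ) * q) := by
      have hlowR : ((∏ p ∈ T, p : ℕ) : ℝ) * ((radical (q ^ k - 1) : ℕ) : ℝ) < ((q ^ k : ℕ) : ℝ) := by
        exact_mod_cast hlow
      have hcombR : (2 : ℝ) ^ (m - 1) * k ≤ ((∏ p ∈ T, p : ℕ) : ℝ) := by
        exact_mod_cast hcomb
      have hupR : ((q ^ k : ℕ) : ℝ) < C * k * (((radical (q ^ k - 1) * q : ℕ) : ℝ)) := hup
      push_cast at hupR
      calc (2 : ℝ) ^ (m - 1) * k * ((radical (q ^ k - 1) : ℕ) : ℝ)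
          ≤ ((∏ p ∈ T, p : ℕ) : ℝ) * ((radical (q ^ k - 1) : ℕ) : ℝ) :=
            mul_le_mul_of_nonneg_right hcombR hR0.le
        _ < ((q ^ k : ℕ) : ℝ) := hlowR
        _ = (q : ℝ) ^ k := by push_cast; ring
        _ < C * k * (((radical (q ^ k - 1) : ℕ) : ℝ) * q) := by
            have : ((q : ℝ) ^ k) = ((q ^ k : ℕ) : ℝ) := by push_cast; ring
            rw [this]; exact_mod_cast hupR
    have h2 : (2 : ℝ) ^ (m - 1) < C * q := by
      have hkr : (0 : ℝ) < k * ((radical (q ^ k - 1) : ℕ) : ℝ) := mul_pos hkR hR0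
      have : (2 : ℝ) ^ (m - 1) * (k * ((radical (q ^ k - 1) : ℕ) : ℝ)) <
          C * q * (k * ((radical (q ^ k - 1) : ℕ) : ℝ)) := by
        have e1 : (2 : ℝ) ^ (m - 1) * (k * ((radical (q ^ k - 1) : ℕ) : ℝ)) =
            (2 : ℝ) ^ (m - 1) * k * ((radical (q ^ k - 1) : ℕ) : ℝ) := by ring
        have e2 : C * q * (k * ((radical (q ^ k - 1) : ℕ) : ℝ)) =
            C * k * (((radical (q ^ k - 1) : ℕ) : ℝ) * q) := by ring
        rw [e1, e2]; exact h1
      exact lt_of_mul_lt_mul_right this hkr.le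
    -- contradiction with `m > C q + 1` and `m ≤ 2^(m-1)`
    linarith
  · -- (⟸) finitely many Wieferich primes: `E_W` bounded, then the upper sandwich
    intro hfin
    obtain ⟨N, hN⟩ := hfin.bddAbove
    have hlev : ∀ p : ℕ, p.Prime → p ≠ 2 → 2 ≤ wieferichLevel q p → p ≤ N := by
      intro p hp hp2 hW
      have hpq : ¬ p ∣ q := fun hdvd => by
        have h0 := wieferichLevel_eq_zero_of_dvd hp hq.one_lt.le hdvd
        omega
      exact hN ⟨hp, (isWieferich_iff_two_le_wieferichLevel hq2 hp hp2 hpq).mpr hW⟩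
    set B : ℕ := ∏ p ∈ (Finset.range (N + 1)).filter Nat.Prime, p ^ (wieferichLevel q p - 1)
    refine ⟨((B : ℝ) * (2 : ℝ) ^ wieferichLevel q 2 + 1), fun k hk => ?_⟩
    have hE : oddWieferichExcess q k ≤ B := oddWieferichExcess_le_of_levels_bounded hlev
    have hsand := (oddWieferichExcess_sandwich hq hk).2
    -- `q^k - 1 ≤ k * rad * E_W * 2^W ≤ k * rad * B * 2^W`
    have h1 : q ^ k - 1 ≤ k * radical (q ^ k - 1) * B * 2 ^ wieferichLevel q 2 := by
      calc q ^ k - 1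
          ≤ k * radical (q ^ k - 1) * oddWieferichExcess q k * 2 ^ wieferichLevel q 2 := hsand
        _ ≤ k * radical (q ^ k - 1) * B * 2 ^ wieferichLevel q 2 := by
            apply Nat.mul_le_mul_right
            exact Nat.mul_le_mul_left _ hE
    have hqk1 : 1 ≤ q ^ k := Nat.one_le_pow _ _ hq.pos
    have h2 : q ^ k ≤ k * radical (q ^ k - 1) * B * 2 ^ wieferichLevel q 2 + 1 := by omega
    rw [rad_family_eq hq hk]
    have hR1 : 1 ≤ radical (q ^ k - 1) := Nat.pos_of_ne_zero radical_ne_zero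
    -- in `ℝ`
    have h2R : ((q ^ k : ℕ) : ℝ) ≤
        (k : ℝ) * ((radical (q ^ k - 1) : ℕ) : ℝ) * B * (2 : ℝ) ^ wieferichLevel q 2 + 1 := by
      exact_mod_cast h2
    have hkR : (1 : ℝ) ≤ k := by exact_mod_cast hk
    have hRR : (1 : ℝ) ≤ ((radical (q ^ k - 1) : ℕ) : ℝ) := by exact_mod_cast hR1
    have hqR : (2 : ℝ) ≤ q := by exact_mod_cast hq2
    have hB0 : (0 : ℝ) ≤ (B : ℝ) * (2 : ℝ) ^ wieferichLevel q 2 := by positivity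
    push_cast
    push_cast at h2R
    -- goal: `q^k < (B 2^W + 1) * k * (rad * q)`
    set X : ℝ := (k : ℝ) * ((radical (q ^ k - 1) : ℕ) : ℝ) with hX
    set Y : ℝ := (B : ℝ) * (2 : ℝ) ^ wieferichLevel q 2 with hY
    have hX1 : 1 ≤ X := by rw [hX]; nlinarith
    have hY0 : 0 ≤ Y := hB0
    have hXY : 0 ≤ X * Y := mul_nonneg (by linarith) hY0
    have h3 : (q : ℝ) ^ k ≤ X * Y + 1 := by
      have e : (k : ℝ) * ((radical (q ^ k - 1) : ℕ) : ℝ) * B * (2 : ℝ) ^ wieferichLevel q 2 =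
          X * Y := by
        rw [hX, hY]; ring
      linarith [h2R, e]
    have h4 : (Y + 1) * X * 2 ≤ (Y + 1) * X * q := by
      apply mul_le_mul_of_nonneg_left hqR
      positivity
    have h5 : ((B : ℝ) * (2 : ℝ) ^ wieferichLevel q 2 + 1) * k * (((radical (q ^ k - 1) : ℕ) : ℝ) * q)
        = (Y + 1) * X * q := by rw [hX, hY]; ring
    rw [h5]
    nlinarith

end Summit.ABC.ABC.Theorems.PrimePowerRadical.Brjuno

end
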